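/-
Copyright (c) 2026. All rights reserved.
Released under Apache 2.0 license as described in the file LICENSE.
-/
import Literature.AlgebraicGeometry.Pohlmann1968.NondegenerateCMTypeDivisorClasses
import Literature.NumberTheory.ComplexMultiplication.CMTypeRankLowerBounds
import Literature.NumberTheory.ComplexMultiplication.CMTypeRankPrimeSquareBound
import HarnessLib

/-!
# Ribet's lower bounds for the rank of a primitive CM type of a CM field: `2 + log₂ n ≤ Rank(Φ)` and
# `p + 1 ≤ Rank(Φ)` for an odd prime `p ∣ n` (Dodson 1987, Thm. 1.0 (iii), Thm. 1.4)

Number-field dress of `NumberTheory/ComplexMultiplication/CMTypeRankLowerBounds.lean` on the tree's CM types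
(`Motives.CMType K`, `K` a CM field, `cmTypeRank Φ = typeRank (ℂ ≃+* ℂ) Φ.1` = Dodson's `Rank(Φ)`, primitivity
`IsPrimitive (ℂ ≃+* ℂ) Φ.1 φ₀` in Shimura's Prop. 26 form, `Aut(ℂ)` acting transitively on `Hom(K, ℂ)` by
`isPretransitive_ringEquiv_complex`), next to `cmTypeRank_le` (`Rank ≤ n + 1`, Dodson Thm. 1.0 (ii)) and
`isNondegenerate_of_isPrimitive_of_prime` (Thm. 1.0 (v), Yanai) of the sibling files.

B. Dodson, J. Algebra 111 (1987) [Dodson1987], p. 49: "`S(n) = {Rank(Φ)}`, where … `(K, Φ)` ranges over all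
primitive types" (`[K:ℚ] = 2n`), "`B(n)`" its minimum; p. 51 THEOREM 1.0 "(iii) `t ∈ S(n)` implies
`log₂(n) + 2 ≤ t`"; THEOREM 1.4 (Ribet) "Let `p` be an odd prime dividing `n`.  Then `B(n) ≥ p + 1`."
K. A. Ribet, Mém. SMF (2) 2 (1980) [Ribet1980], (3.5) p. 87: "`max(2 + Log d, 2 + Log d') ≤ rank(E,S)`" for a simple
CM type `(E,S)`, `2d = [E:ℚ]`.  L. Mai, J. Number Theory 32 (1989) [Mai1989], p. 193: "By Ribet [6],
`r ≥ 2 + log₂ d`."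

Contents (kernel-proved, no named facts): `two_mul_finrank_le_two_pow_cmTypeRank` (`2[K:ℚ] = 4n ≤ 2^{Rank(Φ)}`),
`clog_two_mul_finrank_le_cmTypeRank` (`⌈log₂ 4n⌉ ≤ Rank(Φ)`), `isNondegenerate_of_isPrimitive_of_finrank_le_six` (Ribet's
Examples (3.7): `d ≤ 3 ⟹` nondegenerate), `add_one_le_cmTypeRank_of_prime_dvd` /
`add_one_le_cmTypeRank_of_prime_dvd_half` (`p + 1 ≤ Rank(Φ)` for an odd prime `p ∣ [K:ℚ]`, resp. `p ∣ n` with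
`[K:ℚ] = 2n`); `two_mul_le_cmTypeRank_of_prime_sq_dvd` (`2q ≤ Rank(Φ)` for an odd prime `q` with `q² ∣ [K:ℚ]`,
Dodson's Thm. 1.12, file `CMTypeRankPrimeSquareBound`).
-/

set_option autoImplicit false

open NumberField

namespace Literature.AlgebraicGeometry.Pohlmann1968

open Literature.NumberTheory.ComplexMultiplication
open Literature.AlgebraicGeometry.Motives (CMType)

variable {K : Type} [Field K] [NumberField K] [IsCMField K] (Φ : CMType K)

omit [IsCMField K] in
/-- `|Hom(K, ℂ)| = [K : ℚ]` (Mathlib `NumberField.Embeddings.card`). [folklore] -/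
private theorem card_ringHom_complex_eq : Fintype.card (K →+* ℂ) = Module.finrank ℚ K := Embeddings.card K ℂ

/-- **Ribet's `log₂`-bound on the tree's CM types**: for a primitive CM type `Φ` of a CM field `K`,
`2[K:ℚ] = 4n ≤ 2^{Rank(Φ)}`, i.e. `log₂(n) + 2 ≤ Rank(Φ)` (Dodson Thm. 1.0 (iii); Ribet (3.5); Mai p. 193).
[cite: Dodson1987, Thm. 1.0 (iii) (p. 51)] [cite: Ribet1980, §3 (3.5) (p. 87)] [cite: Mai1989, §1 (p. 193)] -/
theorem two_mul_finrank_le_two_pow_cmTypeRank (φ₀ : K →+* ℂ) (hprim : IsPrimitive (ℂ ≃+* ℂ) Φ.1 φ₀) :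
    2 * Module.finrank ℚ K ≤ 2 ^ cmTypeRank Φ := by
  haveI := isPretransitive_ringEquiv_complex (K := K)
  have h := (isCMTypeWith_conj Φ).two_mul_card_le_two_pow_typeRank_of_isPrimitive hprim
  rwa [card_ringHom_complex_eq] at h

/-- Integer form: `⌈log₂ (2[K:ℚ])⌉ ≤ Rank(Φ)` for a primitive CM type (Dodson's "`log₂`-bound" `[log₂(n)] + 3`,
resp. `log₂(n) + 2` for `n` a power of `2`). [cite: Dodson1987, Thm. 1.0 (iii) (p. 51)] -/
theorem clog_two_mul_finrank_le_cmTypeRank (φ₀ : K →+* ℂ) (hprim : IsPrimitive (ℂ ≃+* ℂ) Φ.1 φ₀) :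
    Nat.clog 2 (2 * Module.finrank ℚ K) ≤ cmTypeRank Φ :=
  Nat.clog_le_of_le_pow (two_mul_finrank_le_two_pow_cmTypeRank Φ φ₀ hprim)

/-- **Ribet's Examples (3.7): a primitive CM type of a CM field of degree `≤ 6` is nondegenerate** — "If
`d = 1, 2, 3`, then the inequalities `2 + Log d ≤ rank(E,S) ≤ d + 1` show that `(E,S)` is always non-degenerate"
(the `log₂`-bound and Kubota's bound `cmTypeRank_le`; for `d = 2, 3` also Yanai's prime-degree theorem
`isNondegenerate_of_isPrimitive_of_prime`). [cite: Ribet1980, §3 Examples (3.7) (p. 87)] -/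
theorem isNondegenerate_of_isPrimitive_of_finrank_le_six (hK : Module.finrank ℚ K ≤ 6) (φ₀ : K →+* ℂ)
    (hprim : IsPrimitive (ℂ ≃+* ℂ) Φ.1 φ₀) : IsNondegenerate Φ := by
  have h1 := two_mul_finrank_le_two_pow_cmTypeRank Φ φ₀ hprim
  have h2 := cmTypeRank_le Φ
  have h0 : 0 < Module.finrank ℚ K := Module.finrank_pos
  rw [isNondegenerate_iff]
  generalize Module.finrank ℚ K = m at *
  generalize cmTypeRank Φ = r at *
  have hr4 : r ≤ 4 := by omega
  interval_cases r <;> norm_num at h1 <;> omega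

/-- **Dodson's Theorem 1.4 (Ribet) on the tree's CM types**: for a primitive CM type `Φ` of a CM field `K` and an
odd prime `p ∣ [K:ℚ]` (equivalently `p ∣ n`, `[K:ℚ] = 2n`), `p + 1 ≤ Rank(Φ)` — "Let `p` be an odd prime dividing
`n`.  Then `B(n) ≥ p + 1`.  In particular, the `log₂`-bound on `B(n)` is not sharp whenever `n` has a sufficiently
large prime factor." [cite: Dodson1987, Thm. 1.4 (pp. 51–52)] -/
theorem add_one_le_cmTypeRank_of_prime_dvd {p : ℕ} (hp : p.Prime) (hp2 : p ≠ 2) (hdvd : p ∣ Module.finrank ℚ K)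
    (φ₀ : K →+* ℂ) (hprim : IsPrimitive (ℂ ≃+* ℂ) Φ.1 φ₀) : p + 1 ≤ cmTypeRank Φ := by
  haveI := isPretransitive_ringEquiv_complex (K := K)
  haveI : Nonempty (K →+* ℂ) := ⟨φ₀⟩
  have hdvd' : p ∣ Fintype.card (K →+* ℂ) := by rwa [card_ringHom_complex_eq]
  exact (isCMTypeWith_conj Φ).add_one_le_typeRank_of_prime_dvd_of_isPrimitive hp hp2 hdvd' hprim

/-- Dodson's Theorem 1.4 (Ribet) with the printed hypothesis "`p` an odd prime dividing `n`", `[K:ℚ] = 2n`.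
[cite: Dodson1987, Thm. 1.4 (pp. 51–52)] -/
theorem add_one_le_cmTypeRank_of_prime_dvd_half {p n : ℕ} (hp : p.Prime) (hp2 : p ≠ 2)
    (hK : Module.finrank ℚ K = 2 * n) (hdvd : p ∣ n) (φ₀ : K →+* ℂ) (hprim : IsPrimitive (ℂ ≃+* ℂ) Φ.1 φ₀) :
    p + 1 ≤ cmTypeRank Φ :=
  add_one_le_cmTypeRank_of_prime_dvd Φ hp hp2 (hK ▸ dvd_mul_of_dvd_right hdvd 2) φ₀ hprim

/-- **Dodson's Theorem 1.12 on the tree's CM types**: for a primitive CM type `Φ` of a CM field `K` and an odd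
prime `q` with `q² ∣ [K:ℚ]` (equivalently `q² ∣ n`, `[K:ℚ] = 2n`), `2q ≤ Rank(Φ)` — "Let `q` be an odd prime for
which `q²` divides `n`.  Then `B(n) ≥ 2q`" (Ribet's method: a subgroup of order `q²` of the Galois image, cyclic or
elementary abelian; `IsCMTypeWith.two_mul_le_typeRank_of_prime_sq_dvd_of_isPrimitive`).
[cite: Dodson1987, Thm. 1.12 (pp. 54–55)] -/
theorem two_mul_le_cmTypeRank_of_prime_sq_dvd {q : ℕ} (hq : q.Prime) (hq2 : q ≠ 2)
    (hdvd : q ^ 2 ∣ Module.finrank ℚ K) (φ₀ : K →+* ℂ) (hprim : IsPrimitive (ℂ ≃+* ℂ) Φ.1 φ₀) :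
    2 * q ≤ cmTypeRank Φ := by
  haveI := isPretransitive_ringEquiv_complex (K := K)
  haveI : Nonempty (K →+* ℂ) := ⟨φ₀⟩
  have hdvd' : q ^ 2 ∣ Fintype.card (K →+* ℂ) := by rwa [card_ringHom_complex_eq]
  exact (isCMTypeWith_conj Φ).two_mul_le_typeRank_of_prime_sq_dvd_of_isPrimitive hq hq2 hdvd' hprim

/-- Dodson's Theorem 1.12 with the printed hypothesis "`q²` divides `n`", `[K:ℚ] = 2n`.
[cite: Dodson1987, Thm. 1.12 (pp. 54–55)] -/
theorem two_mul_le_cmTypeRank_of_prime_sq_dvd_half {q n : ℕ} (hq : q.Prime) (hq2 : q ≠ 2)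
    (hK : Module.finrank ℚ K = 2 * n) (hdvd : q ^ 2 ∣ n) (φ₀ : K →+* ℂ) (hprim : IsPrimitive (ℂ ≃+* ℂ) Φ.1 φ₀) :
    2 * q ≤ cmTypeRank Φ :=
  two_mul_le_cmTypeRank_of_prime_sq_dvd Φ hq hq2 (hK ▸ dvd_mul_of_dvd_right hdvd 2) φ₀ hprim

end Literature.AlgebraicGeometry.Pohlmann1968
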